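import Summits.MatrixMultiplication.MatrixMultiplication.Theses.StabilizerTensorRank
import Literature.Computability.QuantumComplexity.CliffordPermutations
import Literature.Computability.QuantumComplexity.StabilizerSimulationProofs

/-!
# MatrixMultiplication / StabilizerTensorRank — the stabilizer model is Kronecker-closed

Route `MatrixMultiplication/StabilizerTensorRank`, item `stmt-MatrixMultiplication-3833`
(`StabKronecker`, support, rank 9): stabilizer schemes of `⟨2^k, 2^k, 2^k⟩` with `r` terms and of
`⟨2^l, 2^l, 2^l⟩` with `s` terms give a stabilizer scheme of `⟨2^(k+l), 2^(k+l), 2^(k+l)⟩` with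
`r · s` terms. In the vocabulary of `Literature/Computability/AlgebraicComplexity/StabilizerTensorRank.lean`
this is `HasStabilizerScheme k r → HasStabilizerScheme l s → HasStabilizerScheme (k + l) (r * s)`
(`hasStabilizerScheme_mul`); the route decl unfolds to it definitionally (`stabKronecker_proof`).

Proof (index bookkeeping only; no new definitions):

* split an index `a : Fin (2^(k+l))` into its low `k` and high `l` binary digits
  `lo a : Fin (2^k)`, `hi a : Fin (2^l)` (little-endian digit conventions of `finFunctionFinEquiv`,
  exactly those of `legBits`: the first `k` row bits are the low digits of the row index);
  `(lo, hi)` is jointly injective (`eq_of_lowDigits_eq_of_highDigits_eq`), so entrywise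
  `⟨2^(k+l)⟩ (a, b, c) = ⟨2^k⟩ (lo a, lo b, lo c) · ⟨2^l⟩ (hi a, hi b, hi c)`
  (`matMulTensor_apply_eq_mul_of_jointly_injective`) — the bit-concatenation form of "matrix
  tensors multiply", `⟨2^k⟩ ⊠ ⟨2^l⟩ ≅ ⟨2^(k+l)⟩` (Bläser 2013, §5.2 p. 24; cf. the tree's
  `kroneckerTensor_matMulTensor` and `Theorems/AsymptoticSpectrumKronecker.lean`);
* the product legs `W_{ij} (a, b) = w_i (lo a, lo b) · w'_j (hi a, hi b)` decompose `⟨2^(k+l)⟩` with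
  coefficients `c_i d_j` (`matMulTensor_eq_sum_kron`; bilinearity as in Bläser 2013, Lemma 5.8);
* the `2(k+l)`-qubit reading of `W_{ij}` is the tensor product (`tensorVec`) of the readings of
  `w_i` and `w'_j` — a stabilizer state by the tree's `tensorVec_mem_stabilizerStates`
  (Bravyi–Smith–Smolin 2016, §I) — with its wires shuffled by the interleaving
  `Fin ((k+k)+(l+l)) ≃ Fin ((k+l)+(k+l))` of the row/column registers (`Equiv.sumSumSumComm`); wire
  relabellings preserve stabilizer states (the tree's `comp_perm_mem_stabilizerStates`,
  `CliffordPermutations.lean`: SWAP networks are Clifford) — `legBits_kron_mem_stabilizerStates`;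
* reindex `Fin r × Fin s` by `Fin (r * s)` (`hasStabilizerScheme_of_fintype`).
-/

-- single-conjunct summit: the mandated namespace repeats `MatrixMultiplication` (summit = sub-problem).
set_option linter.dupNamespace false

noncomputable section

open scoped BigOperators

namespace Summit.MatrixMultiplication.MatrixMultiplication.Theorems

open Literature.Computability.AlgebraicComplexity Literature.Computability.QuantumComplexity
  Literature.Computability.Cryptography

/-! ### Matrix tensors multiply along a jointly injective index splitting -/

/-- Entrywise form of `⟨N⟩ ≅ ⟨P⟩ ⊠ ⟨Q⟩` along a splitting `a ↦ (lo a, hi a)` of `Fin N` into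
`Fin P × Fin Q` that is jointly injective: the entry of `⟨N,N,N⟩` at `(a, b, c)` is the product of
the entry of `⟨P,P,P⟩` at the `lo`-parts and the entry of `⟨Q,Q,Q⟩` at the `hi`-parts (a
conjunction of index equalities splits digitwise). Bläser 2013, p. 24: "the tensor product of two
matrix tensors is a bigger matrix tensor". [cite: Blaser2013, §5.2 p. 24] -/
theorem matMulTensor_apply_eq_mul_of_jointly_injective {K : Type*} [CommSemiring K] {N P Q : ℕ}
    (lo : Fin N → Fin P) (hi : Fin N → Fin Q)
    (hinj : ∀ a a', lo a = lo a' → hi a = hi a' → a = a') (a b c : Fin N × Fin N) :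
    matMulTensor K N N N a b c =
      matMulTensor K P P P (lo a.1, lo a.2) (lo b.1, lo b.2) (lo c.1, lo c.2) *
        matMulTensor K Q Q Q (hi a.1, hi a.2) (hi b.1, hi b.2) (hi c.1, hi c.2) := by
  simp only [matMulTensor]
  by_cases h : a.1 = b.1 ∧ b.2 = c.1 ∧ a.2 = c.2
  · obtain ⟨h₁, h₂, h₃⟩ := h
    simp [h₁, h₂, h₃]
  · rw [if_neg h]
    by_cases hP : lo a.1 = lo b.1 ∧ lo b.2 = lo c.1 ∧ lo a.2 = lo c.2
    · have hQ : ¬ (hi a.1 = hi b.1 ∧ hi b.2 = hi c.1 ∧ hi a.2 = hi c.2) := fun hQ =>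
        h ⟨hinj _ _ hP.1 hQ.1, hinj _ _ hP.2.1 hQ.2.1, hinj _ _ hP.2.2 hQ.2.2⟩
      rw [if_neg hQ, mul_zero]
    · rw [if_neg hP, zero_mul]

/-- **Kronecker products of decompositions of matrix tensors.** If
`⟨P,P,P⟩ = ∑ᵢ cᵢ · wᵢ ⊗ uᵢ ⊗ vᵢ` and `⟨Q,Q,Q⟩ = ∑ⱼ dⱼ · w'ⱼ ⊗ u'ⱼ ⊗ v'ⱼ` then, along a jointly injective
splitting `(lo, hi)` of `Fin N` into `Fin P × Fin Q`,
`⟨N,N,N⟩ = ∑_{(i,j)} cᵢ dⱼ · Wᵢⱼ ⊗ Uᵢⱼ ⊗ Vᵢⱼ` with the product legs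
`Wᵢⱼ (a, b) = wᵢ (lo a, lo b) · w'ⱼ (hi a, hi b)` (and likewise `U`, `V`): the tensor product of
the two decompositions (Bläser 2013, Lemma 5.8 with p. 24). [cite: Blaser2013, Lemma 5.8] -/
theorem matMulTensor_eq_sum_kron {K : Type*} [CommSemiring K] {N P Q r s : ℕ}
    (lo : Fin N → Fin P) (hi : Fin N → Fin Q)
    (hinj : ∀ a a', lo a = lo a' → hi a = hi a' → a = a')
    {c : Fin r → K} {w u v : Fin r → Fin P × Fin P → K}
    (hP : matMulTensor K P P P = ∑ i, c i • triad (w i) (u i) (v i))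
    {d : Fin s → K} {w' u' v' : Fin s → Fin Q × Fin Q → K}
    (hQ : matMulTensor K Q Q Q = ∑ j, d j • triad (w' j) (u' j) (v' j)) :
    matMulTensor K N N N = ∑ p : Fin r × Fin s, (c p.1 * d p.2) •
      triad (fun ab : Fin N × Fin N => w p.1 (lo ab.1, lo ab.2) * w' p.2 (hi ab.1, hi ab.2))
        (fun ab : Fin N × Fin N => u p.1 (lo ab.1, lo ab.2) * u' p.2 (hi ab.1, hi ab.2))
        (fun ab : Fin N × Fin N => v p.1 (lo ab.1, lo ab.2) * v' p.2 (hi ab.1, hi ab.2)) := by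
  funext a b e
  rw [matMulTensor_apply_eq_mul_of_jointly_injective lo hi hinj, hP, hQ]
  simp only [Finset.sum_apply, Pi.smul_apply, triad_apply, smul_eq_mul]
  rw [Finset.sum_mul_sum, Fintype.sum_prod_type]
  refine Finset.sum_congr rfl fun i _ => Finset.sum_congr rfl fun j _ => ?_
  ring

/-! ### Low and high binary digits -/

/-- **Joint injectivity of the digit splitting.** An element of `Fin (2^(k+l))` is determined by
its low `k` and its high `l` binary digits (digits in the sense of `finFunctionFinEquiv`, the first
`k` digit positions being `Fin.castAdd l`, the last `l` being `Fin.natAdd k`). [folklore] -/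
theorem eq_of_lowDigits_eq_of_highDigits_eq {k l : ℕ} (a a' : Fin (2 ^ (k + l)))
    (h₁ : finFunctionFinEquiv (fun j : Fin k => finFunctionFinEquiv.symm a (Fin.castAdd l j)) =
      finFunctionFinEquiv (fun j : Fin k => finFunctionFinEquiv.symm a' (Fin.castAdd l j)))
    (h₂ : finFunctionFinEquiv (fun j : Fin l => finFunctionFinEquiv.symm a (Fin.natAdd k j)) =
      finFunctionFinEquiv (fun j : Fin l => finFunctionFinEquiv.symm a' (Fin.natAdd k j))) :
    a = a' := by
  have h₁' := congrFun (finFunctionFinEquiv.injective h₁)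
  have h₂' := congrFun (finFunctionFinEquiv.injective h₂)
  apply finFunctionFinEquiv.symm.injective
  funext i
  refine Fin.addCases (fun j => ?_) (fun j => ?_) i
  · exact h₁' j
  · exact h₂' j

/-! ### Readings of product legs are stabilizer states -/

/-- Stabilizer states are closed under relabelling the wires along any bijection `Fin m ≃ Fin n`
(then `m = n`, and this is the tree's `comp_perm_mem_stabilizerStates`: wire permutations are
Clifford SWAP networks, Aaronson–Gottesman 2004, §I). [cite: AaronsonGottesman2004, §I] -/
theorem comp_equiv_mem_stabilizerStates {m n : ℕ} (e : Fin m ≃ Fin n) {ψ : QReg m → ℂ}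
    (hψ : ψ ∈ stabilizerStates m) : (fun x : QReg n => ψ (x ∘ e)) ∈ stabilizerStates n := by
  obtain rfl : m = n := Fin.equiv_iff_eq.mp ⟨e⟩
  exact comp_perm_mem_stabilizerStates e hψ

/-- **The interleaving wire shuffle.** There is a bijection
`Fin ((k+k)+(l+l)) ≃ Fin ((k+l)+(k+l))` sending the blocks
(row-low `k`, column-low `k`, row-high `l`, column-high `l`) of the source to the positions
(row bits = low `k` then high `l`, column bits = low `k` then high `l`) of the target
(`Equiv.sumSumSumComm` transported along `finSumFinEquiv`). [folklore] -/
theorem exists_interleave_equiv (k l : ℕ) :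
    ∃ e : Fin ((k + k) + (l + l)) ≃ Fin ((k + l) + (k + l)),
      (∀ j : Fin k, e (Fin.castAdd (l + l) (Fin.castAdd k j)) = Fin.castAdd (k + l) (Fin.castAdd l j)) ∧
      (∀ j : Fin k, e (Fin.castAdd (l + l) (Fin.natAdd k j)) = Fin.natAdd (k + l) (Fin.castAdd l j)) ∧
      (∀ j : Fin l, e (Fin.natAdd (k + k) (Fin.castAdd l j)) = Fin.castAdd (k + l) (Fin.natAdd k j)) ∧
      (∀ j : Fin l, e (Fin.natAdd (k + k) (Fin.natAdd l j)) = Fin.natAdd (k + l) (Fin.natAdd k j)) := by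
  refine ⟨finSumFinEquiv.symm.trans <|
      (Equiv.sumCongr finSumFinEquiv.symm finSumFinEquiv.symm).trans <|
      (Equiv.sumSumSumComm (Fin k) (Fin k) (Fin l) (Fin l)).trans <|
      (Equiv.sumCongr finSumFinEquiv finSumFinEquiv).trans finSumFinEquiv,
    fun j => ?_, fun j => ?_, fun j => ?_, fun j => ?_⟩ <;> simp [-Fin.natAdd_eq_addNat]

/-- **The reading of a product leg is a stabilizer state.** If the `2k`-qubit reading of
`f : Fin 2^k × Fin 2^k → ℂ` and the `2l`-qubit reading of `g` are stabilizer states, so is the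
`2(k+l)`-qubit reading of the product leg `(a, b) ↦ f (lo a, lo b) · g (hi a, hi b)` (`lo`/`hi` =
low `k` / high `l` binary digits, characterised by `hlo`, `hhi`): it is the tensor product of the
two readings — a stabilizer state, Bravyi–Smith–Smolin 2016, §I (`tensorVec_mem_stabilizerStates`)
— with its wires shuffled by the interleaving of `exists_interleave_equiv`, a wire permutation,
hence Clifford (`comp_perm_mem_stabilizerStates`). [cite: BravyiSmithSmolin2016, §I] -/
theorem legBits_kron_mem_stabilizerStates {k l : ℕ}
    (lo : Fin (2 ^ (k + l)) → Fin (2 ^ k)) (hi : Fin (2 ^ (k + l)) → Fin (2 ^ l))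
    (hlo : ∀ y : Fin (k + l) → Fin 2,
      lo (finFunctionFinEquiv y) = finFunctionFinEquiv (fun j : Fin k => y (Fin.castAdd l j)))
    (hhi : ∀ y : Fin (k + l) → Fin 2,
      hi (finFunctionFinEquiv y) = finFunctionFinEquiv (fun j : Fin l => y (Fin.natAdd k j)))
    {f : Fin (2 ^ k) × Fin (2 ^ k) → ℂ} {g : Fin (2 ^ l) × Fin (2 ^ l) → ℂ}
    (hf : legBits k f ∈ stabilizerStates (k + k)) (hg : legBits l g ∈ stabilizerStates (l + l)) :
    legBits (k + l) (fun ab : Fin (2 ^ (k + l)) × Fin (2 ^ (k + l)) =>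
        f (lo ab.1, lo ab.2) * g (hi ab.1, hi ab.2)) ∈ stabilizerStates ((k + l) + (k + l)) := by
  obtain ⟨e, h1, h2, h3, h4⟩ := exists_interleave_equiv k l
  have hmem := comp_equiv_mem_stabilizerStates e (tensorVec_mem_stabilizerStates hf hg)
  convert hmem using 1
  funext x
  simp only [legBits, tensorVec_apply, Function.comp_apply, hlo, hhi, h1, h2, h3, h4]

/-! ### Kronecker-closedness -/

/-- Kronecker-closedness of the stabilizer model along a given digit splitting `(lo, hi)` of
`Fin (2^(k+l))` (jointly injective and reading off the low `k` / high `l` digits): stabilizer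
schemes of `⟨2^k⟩` with `r` terms and of `⟨2^l⟩` with `s` terms give one of `⟨2^(k+l)⟩` with `r · s`
terms, the product legs being `(a, b) ↦ wᵢ (lo a, lo b) · w'ⱼ (hi a, hi b)`. [folklore] -/
theorem hasStabilizerScheme_mul_of_split {k l r s : ℕ}
    (lo : Fin (2 ^ (k + l)) → Fin (2 ^ k)) (hi : Fin (2 ^ (k + l)) → Fin (2 ^ l))
    (hinj : ∀ a a', lo a = lo a' → hi a = hi a' → a = a')
    (hlo : ∀ y : Fin (k + l) → Fin 2,
      lo (finFunctionFinEquiv y) = finFunctionFinEquiv (fun j : Fin k => y (Fin.castAdd l j)))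
    (hhi : ∀ y : Fin (k + l) → Fin 2,
      hi (finFunctionFinEquiv y) = finFunctionFinEquiv (fun j : Fin l => y (Fin.natAdd k j)))
    (hr : HasStabilizerScheme k r) (hs : HasStabilizerScheme l s) :
    HasStabilizerScheme (k + l) (r * s) := by
  obtain ⟨c, w, u, v, hleg, hsum⟩ := hr
  obtain ⟨d, w', u', v', hleg', hsum'⟩ := hs
  have h := hasStabilizerScheme_of_fintype (k := k + l) (fun p : Fin r × Fin s => c p.1 * d p.2)
    (fun p ab => w p.1 (lo ab.1, lo ab.2) * w' p.2 (hi ab.1, hi ab.2))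
    (fun p ab => u p.1 (lo ab.1, lo ab.2) * u' p.2 (hi ab.1, hi ab.2))
    (fun p ab => v p.1 (lo ab.1, lo ab.2) * v' p.2 (hi ab.1, hi ab.2))
    (fun p => ⟨legBits_kron_mem_stabilizerStates lo hi hlo hhi (hleg p.1).1 (hleg' p.2).1,
      legBits_kron_mem_stabilizerStates lo hi hlo hhi (hleg p.1).2.1 (hleg' p.2).2.1,
      legBits_kron_mem_stabilizerStates lo hi hlo hhi (hleg p.1).2.2 (hleg' p.2).2.2⟩)
    (matMulTensor_eq_sum_kron lo hi hinj hsum hsum')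
  simpa only [Fintype.card_prod, Fintype.card_fin] using h

/-- **Kronecker-closedness of the stabilizer model.** Stabilizer schemes of `⟨2^k, 2^k, 2^k⟩` with
`r` terms and of `⟨2^l, 2^l, 2^l⟩` with `s` terms give a stabilizer scheme of
`⟨2^(k+l), 2^(k+l), 2^(k+l)⟩` with `r · s` terms (`⟨2^k⟩ ⊠ ⟨2^l⟩ ≅ ⟨2^(k+l)⟩` along bit
concatenation; tensor products of stabilizer states are stabilizer; the interleaving of the
row/column registers is a wire permutation, i.e. Clifford). [folklore] -/
theorem hasStabilizerScheme_mul {k l r s : ℕ} (hr : HasStabilizerScheme k r)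
    (hs : HasStabilizerScheme l s) : HasStabilizerScheme (k + l) (r * s) :=
  hasStabilizerScheme_mul_of_split
    (fun a => finFunctionFinEquiv (fun j : Fin k => finFunctionFinEquiv.symm a (Fin.castAdd l j)))
    (fun a => finFunctionFinEquiv (fun j : Fin l => finFunctionFinEquiv.symm a (Fin.natAdd k j)))
    (fun a a' h₁ h₂ => eq_of_lowDigits_eq_of_highDigits_eq a a' h₁ h₂)
    (fun y => by simp) (fun y => by simp) hr hs

/-- **Route item `StabKronecker` (stmt-MatrixMultiplication-3833): the stabilizer model is
Kronecker-closed.** Stabilizer schemes of `⟨2^k⟩` with `r` terms and of `⟨2^l⟩` with `s` terms give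
one of `⟨2^(k+l)⟩` with `r · s` terms; the route decl is definitionally
`∀ k l r s, HasStabilizerScheme k r → HasStabilizerScheme l s → HasStabilizerScheme (k + l) (r * s)`
(`hasStabilizerScheme_iff` is `Iff.rfl`). [folklore] -/
theorem stabKronecker_proof :
    Summit.MatrixMultiplication.MatrixMultiplication.Theses.StabilizerTensorRank.StabKronecker := by
  intro k l r s hr hs
  exact hasStabilizerScheme_mul hr hs

end Summit.MatrixMultiplication.MatrixMultiplication.Theorems

end
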